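import Mathlib.Analysis.SpecialFunctions.Log.Deriv
import Mathlib.Analysis.SpecialFunctions.Pow.Real
import Mathlib.Analysis.SpecialFunctions.Sqrt
import Mathlib.Analysis.InnerProductSpace.Calculus
import Literature.Topology.FourManifolds.CollarUniquenessBall
import Literature.Topology.FourManifolds.Cobordism
import HarnessLib

/-!
# Compactly supported flat collars of the half space extend to diffeomorphisms

Let `μ` be a *supported flat collar* of the boundary hyperplane `{w 0 = 0}` of the closed half
space `ℝᵏ⁺¹₊ = {w | 0 ≤ w 0}` (`Literature.Topology.FourManifolds.FlatCollar.IsSupportedFlatCollar`): a map `C^∞` on a slab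
`{0 ≤ w 0 < η}`, fixing the hyperplane pointwise, carrying the open slab into the open half
space, equal to the identity wherever `‖tail w‖ ≥ R₁`, and admitting a two-sided `C^∞` local
inverse near the slab. The main result `Literature.Topology.FourManifolds.FlatCollar.IsSupportedFlatCollar.exists_diffeomorph`
produces a diffeomorphism `Θ` of `ℝᵏ⁺¹₊` (model with boundary `𝓡∂ (k + 1)`) with `Θ = μ` on a
thinner slab `{w 0 ≤ η₁}`, `Θ = id` on `{η₂ ≤ w 0}` and wherever `‖tail w‖ ≥ R₁`, fixing the
hyperplane pointwise. This is the compactly supported, relative form of the uniqueness of collars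
(Hirsch, *Differential Topology*, Ch. 8, Thm. 1.8 and the remark on collars following it;
Munkres, *Elementary Differential Topology*, §6) used to make gluing witnesses adapted to a pair
of half-discs (`Literature.Topology.FourManifolds.exists_seamAdaptedWitnesses`, `CorkDecompositionSplittingProof.lean`).

## Strategy

No new hard analysis is done here: the estimates live in the tree's
`Literature.Topology.FourManifolds.CollarUniquenessBall` (inner collars of the unit sphere,
spliced with the identity along a logarithmically slow radial cutoff). We transplant:

* §1–§2 The diffeomorphism `toBall : ℝᵏ⁺¹ → {y | 0 < y 0}`, `w ↦ e^{-w 0} (1, tail w)/√(1 + ‖tail w‖²)`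
  (inverse `fromBall y = (-log ‖y‖, tail y / y 0)`), carrying the closed half space onto the
  punctured closed unit ball within the open cone `{0 < y 0}`, the hyperplane onto the open upper
  hemisphere, and the depth `w 0` to the logarithmic depth `-log ‖y‖`.
* §3 Supported flat collars; the transplant `θ = toBall ∘ μ ∘ fromBall` (identity off the cone)
  is an inner collar of the unit sphere (`isInnerCollar_transplant`; off the cone and near the
  equator the tangential size after `fromBall` is large, so `θ = id` there), and the tree's splice
  `Literature.Topology.FourManifolds.IsInnerCollar.splice` is a bijection of the closed unit ball, `C^∞` with `C^∞` inverse up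
  to the sphere in the within sense (`contDiffOn_splice_closedBall`,
  `contDiffOn_spliceInv_closedBall`).
* §4 Conjugating back, `halfSplice = fromBall ∘ splice ∘ toBall` is a within-`C^∞` bijection of
  the closed half space equal to `μ` near the hyperplane and to the identity deep inside and far
  out.
* §5 Within-`C^∞` coordinate self-maps of `{0 ≤ w 0}` induce `C^∞` maps of
  `EuclideanHalfSpace (k + 1)` (`contMDiff_halfSpaceMk`, `halfSpaceDiffeomorph`).
* §6 The main result.

## References

* M. W. Hirsch, *Differential Topology*, GTM 33, Springer (1976), Ch. 8, Thm. 1.8; §4.6.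
* J. R. Munkres, *Elementary Differential Topology*, Princeton (1966), §6.
-/

open scoped Topology ContDiff Manifold
open Set Function Metric Filter Real

noncomputable section

namespace Literature.Topology.FourManifolds

namespace FlatCollar

/-- Local notation: `𝔼 n` is the model Euclidean space. -/
local notation "𝔼 " n:arg => EuclideanSpace ℝ (Fin n)

open BoundaryManifold

variable {k : ℕ}

/-! ### §1 Height and tail -/

/-- `‖(t, u)‖² = t² + ‖u‖²` in `ℝᵏ⁺¹ = ℝ × ℝᵏ`. [folklore] -/
theorem norm_sq_consCLE (u : 𝔼 k) (t : ℝ) : ‖consCLE k (u, t)‖ ^ 2 = t ^ 2 + ‖u‖ ^ 2 := by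
  rw [EuclideanSpace.norm_sq_eq, EuclideanSpace.norm_sq_eq, Fin.sum_univ_succ]
  simp [consCLE_apply_zero, consCLE_apply_succ]

/-- `‖x‖² = (x 0)² + ‖tail x‖²`. [folklore] -/
theorem norm_sq_eq_sq_add (x : 𝔼 (k + 1)) : ‖x‖ ^ 2 = (x 0) ^ 2 + ‖tail k x‖ ^ 2 := by
  conv_lhs => rw [← consCLE_tail k x]
  exact norm_sq_consCLE _ _

/-- `|x 0| ≤ ‖x‖`. [folklore] -/
theorem abs_apply_zero_le_norm (x : 𝔼 (k + 1)) : |x 0| ≤ ‖x‖ := by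
  have h := norm_sq_eq_sq_add x
  have h1 : (x 0) ^ 2 ≤ ‖x‖ ^ 2 := by nlinarith [norm_nonneg (tail k x)]
  rw [← Real.sqrt_sq_eq_abs, ← Real.sqrt_sq (norm_nonneg x)]
  exact Real.sqrt_le_sqrt h1

/-- `‖tail x‖ ≤ ‖x‖`. [folklore] -/
theorem norm_tail_le (x : 𝔼 (k + 1)) : ‖tail k x‖ ≤ ‖x‖ := by
  have h := norm_sq_eq_sq_add x
  have h1 : ‖tail k x‖ ^ 2 ≤ ‖x‖ ^ 2 := by nlinarith [sq_nonneg (x 0)]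
  rw [← Real.sqrt_sq (norm_nonneg (tail k x)), ← Real.sqrt_sq (norm_nonneg x)]
  exact Real.sqrt_le_sqrt h1

/-- `tail` of a scalar multiple. [folklore] -/
theorem tail_smul (c : ℝ) (x : 𝔼 (k + 1)) : tail k (c • x) = c • tail k x := by
  simp [tail]

/-- The height `x ↦ x 0` is smooth (cf. `Literature.Topology.FourManifolds.contDiff_euclidean_apply_zero` in
`HalfDiscFromCollar.lean`, not imported here). [folklore] -/
theorem contDiff_apply_zero : ContDiff ℝ ∞ fun x : 𝔼 (k + 1) => x 0 := by
  have : ContDiff ℝ ∞ fun x : 𝔼 (k + 1) => ((consCLE k).symm x).2 :=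
    contDiff_snd.comp (consCLE k).symm.contDiff
  exact this

/-! ### §2 The transplant: half space → closed unit ball

`toBall w = e^{-w 0} • capPoint (tail w)`, where `capPoint u = (1, u) / √(1 + ‖u‖²)` is the
central (gnomonic) parametrisation of the open upper hemisphere: a diffeomorphism of `ℝᵏ⁺¹` onto
the open cone `{y | 0 < y 0}` taking the closed half space `{0 ≤ w 0}` onto the punctured closed
unit ball within the cone, the hyperplane `{w 0 = 0}` onto the open hemisphere and the depth `w 0`
to the logarithmic depth `-log ‖y‖`. -/

/-- The central parametrisation of the open upper unit hemisphere: `u ↦ (1, u) / √(1 + ‖u‖²)`.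
[folklore] -/
def capPoint (u : 𝔼 k) : 𝔼 (k + 1) := (Real.sqrt (1 + ‖u‖ ^ 2))⁻¹ • consCLE k (u, 1)

/-- `√(1 + ‖u‖²) > 0`. [folklore] -/
theorem sqrt_one_add_sq_pos (u : 𝔼 k) : 0 < Real.sqrt (1 + ‖u‖ ^ 2) :=
  Real.sqrt_pos.2 (by positivity)

/-- The height of `capPoint u` is `1 / √(1 + ‖u‖²)`. [folklore] -/
theorem capPoint_apply_zero (u : 𝔼 k) : capPoint u 0 = (Real.sqrt (1 + ‖u‖ ^ 2))⁻¹ := by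
  simp [capPoint, consCLE_apply_zero]

/-- The height of `capPoint u` is positive. [folklore] -/
theorem capPoint_apply_zero_pos (u : 𝔼 k) : 0 < capPoint u 0 := by
  rw [capPoint_apply_zero]; exact inv_pos.2 (sqrt_one_add_sq_pos u)

/-- The tail of `capPoint u` is `u / √(1 + ‖u‖²)`. [folklore] -/
theorem tail_capPoint (u : 𝔼 k) : tail k (capPoint u) = (Real.sqrt (1 + ‖u‖ ^ 2))⁻¹ • u := by
  rw [capPoint, tail_smul, tail_consCLE]

/-- `capPoint u` is a unit vector. [folklore] -/
theorem norm_capPoint (u : 𝔼 k) : ‖capPoint u‖ = 1 := by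
  have hs := sqrt_one_add_sq_pos u
  have h2 : ‖capPoint u‖ ^ 2 = 1 := by
    rw [capPoint, norm_smul, mul_pow, norm_sq_consCLE, norm_inv, Real.norm_eq_abs,
      abs_of_pos hs, inv_pow, Real.sq_sqrt (by positivity)]
    field_simp
  have h0 : 0 ≤ ‖capPoint u‖ := norm_nonneg _
  nlinarith [h2, h0]

/-- `capPoint` is smooth. [folklore] -/
theorem contDiff_capPoint : ContDiff ℝ ∞ (capPoint : 𝔼 k → 𝔼 (k + 1)) := by
  refine ContDiff.smul (ContDiff.inv ?_ fun u => (sqrt_one_add_sq_pos u).ne') ?_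
  · exact (contDiff_const.add (contDiff_norm_sq ℝ)).sqrt fun u => by positivity
  · exact (consCLE k).contDiff.comp (contDiff_id.prodMk contDiff_const)

/-- **The transplant** `w ↦ e^{-w 0} • capPoint (tail w)` of `ℝᵏ⁺¹` onto the open cone
`{0 < y 0}`. [folklore] -/
def toBall (w : 𝔼 (k + 1)) : 𝔼 (k + 1) := Real.exp (-(w 0)) • capPoint (tail k w)

/-- **Its inverse** `y ↦ (-log ‖y‖, tail y / y 0)` (on the cone `{0 < y 0}`). [folklore] -/
def fromBall (y : 𝔼 (k + 1)) : 𝔼 (k + 1) := consCLE k ((y 0)⁻¹ • tail k y, -Real.log ‖y‖)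

/-- `‖toBall w‖ = e^{-w 0}`. [folklore] -/
theorem norm_toBall (w : 𝔼 (k + 1)) : ‖toBall w‖ = Real.exp (-(w 0)) := by
  rw [toBall, norm_smul, norm_capPoint, mul_one, Real.norm_eq_abs, abs_of_pos (Real.exp_pos _)]

/-- `toBall w ≠ 0`. [folklore] -/
theorem toBall_ne_zero (w : 𝔼 (k + 1)) : toBall w ≠ 0 := by
  rw [← norm_ne_zero_iff, norm_toBall]; exact (Real.exp_pos _).ne'

/-- The height of `toBall w` is `e^{-w 0} / √(1 + ‖tail w‖²) > 0`. [folklore] -/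
theorem toBall_apply_zero (w : 𝔼 (k + 1)) :
    toBall w 0 = Real.exp (-(w 0)) * (Real.sqrt (1 + ‖tail k w‖ ^ 2))⁻¹ := by
  simp [toBall, capPoint_apply_zero]

/-- The transplant lands in the cone `{0 < y 0}`. [folklore] -/
theorem toBall_apply_zero_pos (w : 𝔼 (k + 1)) : 0 < toBall w 0 := by
  rw [toBall_apply_zero]
  exact mul_pos (Real.exp_pos _) (inv_pos.2 (sqrt_one_add_sq_pos _))

/-- The tail of `toBall w`. [folklore] -/
theorem tail_toBall (w : 𝔼 (k + 1)) :
    tail k (toBall w) = (Real.exp (-(w 0)) * (Real.sqrt (1 + ‖tail k w‖ ^ 2))⁻¹) • tail k w := by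
  rw [toBall, tail_smul, tail_capPoint, smul_smul]

/-- `‖toBall w‖ ≤ 1` iff `0 ≤ w 0`. [folklore] -/
theorem norm_toBall_le_one_iff (w : 𝔼 (k + 1)) : ‖toBall w‖ ≤ 1 ↔ 0 ≤ w 0 := by
  rw [norm_toBall, Real.exp_le_one_iff, neg_nonpos]

/-- `‖toBall w‖ < 1` iff `0 < w 0`. [folklore] -/
theorem norm_toBall_lt_one_iff (w : 𝔼 (k + 1)) : ‖toBall w‖ < 1 ↔ 0 < w 0 := by
  rw [norm_toBall, Real.exp_lt_one_iff, neg_lt_zero]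

/-- `‖toBall w‖ = 1` iff `w 0 = 0`. [folklore] -/
theorem norm_toBall_eq_one_iff (w : 𝔼 (k + 1)) : ‖toBall w‖ = 1 ↔ w 0 = 0 := by
  rw [norm_toBall, Real.exp_eq_one_iff, neg_eq_zero]

/-- The height of `fromBall y` is `-log ‖y‖`. [folklore] -/
theorem fromBall_apply_zero (y : 𝔼 (k + 1)) : fromBall y 0 = -Real.log ‖y‖ := by
  rw [fromBall, consCLE_apply_zero]

/-- The tail of `fromBall y` is `tail y / y 0`. [folklore] -/
theorem tail_fromBall (y : 𝔼 (k + 1)) : tail k (fromBall y) = (y 0)⁻¹ • tail k y := by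
  rw [fromBall, tail_consCLE]

/-- **`fromBall ∘ toBall = id`.** [folklore] -/
theorem fromBall_toBall (w : 𝔼 (k + 1)) : fromBall (toBall w) = w := by
  have hs := sqrt_one_add_sq_pos (tail k w)
  have he := Real.exp_pos (-(w 0))
  rw [fromBall, norm_toBall, Real.log_exp, neg_neg, tail_toBall, toBall_apply_zero, smul_smul,
    inv_mul_cancel₀ (mul_pos he (inv_pos.2 hs)).ne', one_smul, consCLE_tail]

/-- **`toBall ∘ fromBall = id` on the cone `{0 < y 0}`.** [folklore] -/
theorem toBall_fromBall {y : 𝔼 (k + 1)} (hy : 0 < y 0) : toBall (fromBall y) = y := by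
  have hy0 : y ≠ 0 := fun h => by rw [h] at hy; exact lt_irrefl _ hy
  have hn : 0 < ‖y‖ := norm_pos_iff.2 hy0
  -- `√(1 + ‖tail y / y 0‖²) = ‖y‖ / y 0`
  have hsq : Real.sqrt (1 + ‖(y 0)⁻¹ • tail k y‖ ^ 2) = ‖y‖ / y 0 := by
    rw [norm_smul, mul_pow, norm_inv, Real.norm_eq_abs, abs_of_pos hy, inv_pow]
    have h1 : 1 + (y 0 ^ 2)⁻¹ * ‖tail k y‖ ^ 2 = (‖y‖ / y 0) ^ 2 := by
      rw [div_pow, norm_sq_eq_sq_add y]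
      field_simp
    rw [h1, Real.sqrt_sq (div_nonneg hn.le hy.le)]
  rw [toBall, fromBall_apply_zero, neg_neg, Real.exp_log hn, tail_fromBall, capPoint, hsq,
    smul_smul]
  have h2 : ‖y‖ * (‖y‖ / y 0)⁻¹ = y 0 := by field_simp
  have h3 : y 0 • ((y 0)⁻¹ • tail k y, (1 : ℝ)) = (tail k y, y 0) := by
    ext1
    · rw [Prod.smul_fst, smul_smul, mul_inv_cancel₀ hy.ne', one_smul]
    · rw [Prod.smul_snd, smul_eq_mul, mul_one]
  rw [h2, ← (consCLE k).map_smul, h3, consCLE_tail]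

/-- The transplant is smooth. [folklore] -/
theorem contDiff_toBall : ContDiff ℝ ∞ (toBall : 𝔼 (k + 1) → 𝔼 (k + 1)) :=
  (contDiff_apply_zero.neg.exp).smul (contDiff_capPoint.comp (contDiff_tail k))

/-- The inverse transplant is smooth on the cone `{0 < y 0}`. [folklore] -/
theorem contDiffAt_fromBall {y : 𝔼 (k + 1)} (hy : 0 < y 0) : ContDiffAt ℝ ∞ fromBall y := by
  have hy0 : y ≠ 0 := fun h => by rw [h] at hy; exact lt_irrefl _ hy
  refine (consCLE k).contDiff.contDiffAt.comp y (ContDiffAt.prodMk ?_ ?_)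
  · exact ((contDiff_apply_zero.contDiffAt).inv hy.ne').smul (contDiff_tail k).contDiffAt
  · exact ((contDiffAt_norm ℝ hy0).log (norm_ne_zero_iff.2 hy0)).neg

/-- The inverse transplant is smooth on the cone, `ContDiffOn` form. [folklore] -/
theorem contDiffOn_fromBall : ContDiffOn ℝ ∞ (fromBall : 𝔼 (k + 1) → 𝔼 (k + 1)) {y | 0 < y 0} :=
  fun _ hy => (contDiffAt_fromBall hy).contDiffWithinAt

/-- The cone `{0 < y 0}` is open. [folklore] -/
theorem isOpen_cone : IsOpen {y : 𝔼 (k + 1) | 0 < y 0} :=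
  isOpen_lt continuous_const contDiff_apply_zero.continuous

/-! ### §3 Supported flat collars and their transplants -/

/-- **A compactly supported flat collar of the boundary hyperplane of the half space** (with a
two-sided local inverse). `μ` is `C^∞` on the slab `{0 ≤ w 0 < η}` of the closed half space (in
the within sense at the hyperplane), fixes the hyperplane `{w 0 = 0}` pointwise, maps the open
slab into the open half space, is the identity where `‖tail w‖ ≥ R₁`, and moves tails of size
`< R₁` to tails of size `< R₂`; `M` is an open partial homeomorphism of `ℝᵏ⁺¹` (a two-sided
extension of `μ` near the slab) whose source and target contain the box
`{|w 0| < η, ‖tail w‖ < R₂ + 1}`, which agrees with `μ` on the slab, is the identity where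
`‖tail w‖ ≥ R₁`, and has `C^∞` inverse. This is how the comparison map `k_B⁻¹ ∘ j_B⁻¹ ∘ K ∘ r`
between the two collars of the seam of a gluing presents itself after a tangential cut-off
(Hirsch, *Differential Topology*, Ch. 8, Thm. 1.8–1.9; Munkres, *Elementary Differential
Topology*, §6). [cite: HirschDT1976, Ch. 8 Thm. 1.8] -/
structure IsSupportedFlatCollar (η R₁ R₂ : ℝ) (μ : 𝔼 (k + 1) → 𝔼 (k + 1))
    (M : OpenPartialHomeomorph (𝔼 (k + 1)) (𝔼 (k + 1))) : Prop where
  η_pos : 0 < η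
  R₁_pos : 0 < R₁
  R₁_le : R₁ ≤ R₂
  contDiffOn : ContDiffOn ℝ ∞ μ {w | 0 ≤ w 0 ∧ w 0 < η}
  eq_self_of_eq_zero : ∀ w, w 0 = 0 → μ w = w
  apply_zero_pos : ∀ w, 0 < w 0 → w 0 < η → 0 < μ w 0
  eq_self_of_le_norm : ∀ w, 0 ≤ w 0 → w 0 < η → R₁ ≤ ‖tail k w‖ → μ w = w
  norm_tail_lt : ∀ w, 0 ≤ w 0 → w 0 < η → ‖tail k w‖ < R₁ → ‖tail k (μ w)‖ < R₂
  box_subset_source : {w | |w 0| < η ∧ ‖tail k w‖ < R₂ + 1} ⊆ M.source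
  box_subset_target : {w | |w 0| < η ∧ ‖tail k w‖ < R₂ + 1} ⊆ M.target
  eqOn_source : ∀ w ∈ M.source, 0 ≤ w 0 → w 0 < η → M w = μ w
  eq_self_source : ∀ w ∈ M.source, R₁ ≤ ‖tail k w‖ → M w = w
  contDiffOn_symm : ContDiffOn ℝ ∞ M.symm M.target

/-- **The transplanted collar** `θ = toBall ∘ μ ∘ fromBall` on the cone `{0 < y 0}`, the identity
elsewhere. [folklore] -/
def transplant (μ : 𝔼 (k + 1) → 𝔼 (k + 1)) (y : 𝔼 (k + 1)) : 𝔼 (k + 1) :=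
  if 0 < y 0 then toBall (μ (fromBall y)) else y

/-- **Its inverse** `toBall ∘ M⁻¹ ∘ fromBall` on the part of the cone of tangential size
`< R₂ + 1/2`, the identity elsewhere. [folklore] -/
def transplantInv (R₂ : ℝ) (M : OpenPartialHomeomorph (𝔼 (k + 1)) (𝔼 (k + 1))) (y : 𝔼 (k + 1)) :
    𝔼 (k + 1) :=
  if 0 < y 0 ∧ ‖tail k (fromBall y)‖ < R₂ + 1 / 2 then toBall (M.symm (fromBall y)) else y

/-- The width `(1 - e^{-η}) / 2` of the shell corresponding to the slab of depth `η`. [folklore] -/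
def shellWidth (η : ℝ) : ℝ := (1 - Real.exp (-η)) / 2

section Transplant

variable {η R₁ R₂ : ℝ} {μ : 𝔼 (k + 1) → 𝔼 (k + 1)}
  {M : OpenPartialHomeomorph (𝔼 (k + 1)) (𝔼 (k + 1))}

/-- The shell width is positive. [folklore] -/
theorem shellWidth_pos (hη : 0 < η) : 0 < shellWidth η := by
  have : Real.exp (-η) < 1 := Real.exp_lt_one_iff.2 (by linarith)
  unfold shellWidth; linarith

/-- In the shell the logarithmic depth is less than `η`. [folklore] -/
theorem neg_log_norm_lt (hη : 0 < η) {y : 𝔼 (k + 1)} (hy : 1 - shellWidth η < ‖y‖) :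
    -Real.log ‖y‖ < η := by
  have he : Real.exp (-η) < 1 := Real.exp_lt_one_iff.2 (by linarith)
  have h1 : Real.exp (-η) < ‖y‖ := by unfold shellWidth at hy; linarith
  have h2 := Real.log_lt_log (Real.exp_pos _) h1
  rw [Real.log_exp] at h2
  linarith

/-- In the closed ball the logarithmic depth is nonnegative. [folklore] -/
theorem neg_log_norm_nonneg {y : 𝔼 (k + 1)} (hy0 : 0 < ‖y‖) (hy : ‖y‖ ≤ 1) : 0 ≤ -Real.log ‖y‖ := by
  have := Real.log_nonpos hy0.le hy; linarith

/-- Points of the shell are nonzero. [folklore] -/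
theorem norm_pos_of_mem_closedShell (hη : 0 < η) {y : 𝔼 (k + 1)}
    (hy : y ∈ (closedShell (shellWidth η) : Set (𝔼 (k + 1)))) : 0 < ‖y‖ := by
  rw [mem_closedShell_iff] at hy
  have he : Real.exp (-η) < 1 := Real.exp_lt_one_iff.2 (by linarith)
  have : 0 < 1 - shellWidth η := by unfold shellWidth; linarith [Real.exp_pos (-η)]
  linarith [hy.1]

/-- The depth of a shell point lies in the slab `[0, η)`. [folklore] -/
theorem fromBall_mem_slab (hη : 0 < η) {y : 𝔼 (k + 1)}
    (hy : y ∈ (closedShell (shellWidth η) : Set (𝔼 (k + 1)))) :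
    0 ≤ fromBall y 0 ∧ fromBall y 0 < η := by
  have h0 := norm_pos_of_mem_closedShell hη hy
  rw [mem_closedShell_iff] at hy
  rw [fromBall_apply_zero]
  exact ⟨neg_log_norm_nonneg h0 hy.2, neg_log_norm_lt hη hy.1⟩

/-- `|fromBall y 0| < η` for shell points. [folklore] -/
theorem abs_fromBall_lt (hη : 0 < η) {y : 𝔼 (k + 1)}
    (hy : y ∈ (closedShell (shellWidth η) : Set (𝔼 (k + 1)))) : |fromBall y 0| < η := by
  obtain ⟨h1, h2⟩ := fromBall_mem_slab hη hy
  rw [abs_of_nonneg h1]; exact h2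

/-- On the cone, the tangential size after `fromBall` is `‖tail y‖ / y 0`. [folklore] -/
theorem norm_tail_fromBall {y : 𝔼 (k + 1)} (hy : 0 < y 0) :
    ‖tail k (fromBall y)‖ = ‖tail k y‖ / y 0 := by
  rw [tail_fromBall, norm_smul, norm_inv, Real.norm_eq_abs, abs_of_pos hy, div_eq_inv_mul]

namespace IsSupportedFlatCollar

omit μ M in
/-- **The standard collar is a supported flat collar**: `μ = id` with the two-sided extension
`id` (non-vacuity of the notion). [folklore] -/
protected theorem id (hη : 0 < η) (hR₁ : 0 < R₁) (hR : R₁ ≤ R₂) :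
    IsSupportedFlatCollar (k := k) η R₁ R₂ _root_.id (OpenPartialHomeomorph.refl _) where
  η_pos := hη
  R₁_pos := hR₁
  R₁_le := hR
  contDiffOn := contDiff_id.contDiffOn
  eq_self_of_eq_zero _ _ := rfl
  apply_zero_pos _ h _ := h
  eq_self_of_le_norm _ _ _ _ := rfl
  norm_tail_lt _ _ _ h := h.trans_le hR
  box_subset_source _ _ := mem_univ _
  box_subset_target _ _ := mem_univ _
  eqOn_source _ _ _ _ := rfl
  eq_self_source _ _ _ := rfl
  contDiffOn_symm := contDiff_id.contDiffOn

/-- `μ` maps the slab into the closed half space. [folklore] -/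
theorem apply_zero_nonneg (h : IsSupportedFlatCollar η R₁ R₂ μ M) {w : 𝔼 (k + 1)} (h0 : 0 ≤ w 0)
    (hη : w 0 < η) : 0 ≤ μ w 0 := by
  rcases h0.lt_or_eq with h0 | h0
  · exact (h.apply_zero_pos w h0 hη).le
  · rw [h.eq_self_of_eq_zero w h0.symm]; exact h0.le

/-- On the slab, tails of size `≥ R₁` are kept and tails of size `< R₁` stay `< R₂`; in all
cases the tangential size stays below `max ‖tail w‖ R₂`. [folklore] -/
theorem norm_tail_apply_lt (h : IsSupportedFlatCollar η R₁ R₂ μ M) {w : 𝔼 (k + 1)} (h0 : 0 ≤ w 0)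
    (hη : w 0 < η) {R : ℝ} (hR : R₂ ≤ R) (hw : ‖tail k w‖ < R) : ‖tail k (μ w)‖ < R := by
  by_cases hw1 : ‖tail k w‖ < R₁
  · exact (h.norm_tail_lt w h0 hη hw1).trans_le hR
  · rw [h.eq_self_of_le_norm w h0 hη (le_of_not_gt hw1)]; exact hw

/-- `M⁻¹ = id` on points of the box with tail of size `≥ R₁`. [folklore] -/
theorem symm_eq_self (h : IsSupportedFlatCollar η R₁ R₂ μ M) {w : 𝔼 (k + 1)} (hw : |w 0| < η)
    (hw' : ‖tail k w‖ < R₂ + 1) (hR : R₁ ≤ ‖tail k w‖) : M.symm w = w := by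
  have hs : w ∈ M.source := h.box_subset_source ⟨hw, hw'⟩
  conv_lhs => rw [← h.eq_self_source w hs hR]
  exact M.left_inv hs

/-- `M⁻¹ (μ w) = w` on the part of the slab in the box. [folklore] -/
theorem symm_apply (h : IsSupportedFlatCollar η R₁ R₂ μ M) {w : 𝔼 (k + 1)} (h0 : 0 ≤ w 0)
    (hη : w 0 < η) (hw' : ‖tail k w‖ < R₂ + 1) : M.symm (μ w) = w := by
  have hs : w ∈ M.source := h.box_subset_source ⟨by rw [abs_of_nonneg h0]; exact hη, hw'⟩
  rw [← h.eqOn_source w hs h0 hη]; exact M.left_inv hs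

/-- **The transplant of a supported flat collar is an inner collar of the unit sphere** (in the
sense of `Literature.Topology.FourManifolds.IsInnerCollar`, `CollarUniquenessBall.lean`), of width `(1 - e^{-η}) / 2`.
[folklore] -/
theorem isInnerCollar_transplant (h : IsSupportedFlatCollar η R₁ R₂ μ M) :
    IsInnerCollar (shellWidth η) (transplant μ) (transplantInv R₂ M) := by
  have hη := h.η_pos
  have hcone : IsOpen {y : 𝔼 (k + 1) | 0 < y 0} := isOpen_cone
  -- the formula on the cone, within the shell
  have hθ_cone : ∀ y ∈ (closedShell (shellWidth η) : Set (𝔼 (k + 1))), 0 < y 0 →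
      ContDiffWithinAt ℝ ∞ (transplant μ) (closedShell (shellWidth η)) y := by
    intro y hy hy0
    have hgerm : ContDiffWithinAt ℝ ∞ (fun y => toBall (μ (fromBall y)))
        (closedShell (shellWidth η)) y := by
      have h1 : ContDiffWithinAt ℝ ∞ fromBall (closedShell (shellWidth η)) y :=
        (contDiffAt_fromBall hy0).contDiffWithinAt
      have h2 : ContDiffWithinAt ℝ ∞ μ {w | 0 ≤ w 0 ∧ w 0 < η} (fromBall y) :=
        h.contDiffOn _ (fromBall_mem_slab hη hy)
      have h12 := h2.comp y h1 fun y' hy' => fromBall_mem_slab hη hy'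
      exact contDiff_toBall.contDiffAt.comp_contDiffWithinAt y h12
    refine hgerm.congr_of_eventuallyEq ?_ (by simp [transplant, hy0])
    filter_upwards [mem_nhdsWithin_of_mem_nhds (hcone.mem_nhds hy0)] with y' hy'
    simp [transplant, show 0 < y' 0 from hy']
  -- off the cone the transplant is the identity nearby (within the shell)
  have hθ_off : ∀ y ∈ (closedShell (shellWidth η) : Set (𝔼 (k + 1))), ¬ 0 < y 0 →
      ∀ᶠ y' in 𝓝[closedShell (shellWidth η)] y, transplant μ y' = y' ∧
        transplantInv R₂ M y' = y' := by
    intro y hy hy0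
    have hO : IsOpen {y' : 𝔼 (k + 1) | R₁ * y' 0 < ‖tail k y'‖} :=
      isOpen_lt (continuous_const.mul contDiff_apply_zero.continuous)
        (continuous_norm.comp (contDiff_tail k).continuous)
    have hyO : R₁ * y 0 < ‖tail k y‖ := by
      rcases (le_of_not_gt hy0).lt_or_eq with hlt | heq
      · exact (mul_neg_of_pos_of_neg h.R₁_pos hlt).trans_le (norm_nonneg _)
      · have hn := norm_pos_of_mem_closedShell hη hy
        have h2 := norm_sq_eq_sq_add y
        rw [heq, mul_zero]
        rw [heq] at h2
        nlinarith [norm_nonneg (tail k y)]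
    filter_upwards [mem_nhdsWithin_of_mem_nhds (hO.mem_nhds hyO), self_mem_nhdsWithin]
      with y' hy'O hy's
    by_cases hy'0 : 0 < y' 0
    · -- the tail after `fromBall` is large, so `μ = id` and `M⁻¹ = id`
      have hw := fromBall_mem_slab hη hy's
      have htail : R₁ < ‖tail k (fromBall y')‖ := by
        rw [norm_tail_fromBall hy'0, lt_div_iff₀ hy'0]; exact hy'O
      have hμ : μ (fromBall y') = fromBall y' := h.eq_self_of_le_norm _ hw.1 hw.2 htail.le
      refine ⟨by rw [transplant, if_pos hy'0, hμ, toBall_fromBall hy'0], ?_⟩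
      rw [transplantInv]
      split_ifs with hc
      · rw [h.symm_eq_self (abs_fromBall_lt hη hy's) (by linarith [hc.2]) htail.le,
          toBall_fromBall hy'0]
      · rfl
    · exact ⟨by rw [transplant, if_neg hy'0], by rw [transplantInv, if_neg (fun hc => hy'0 hc.1)]⟩
  refine ⟨shellWidth_pos hη, ?_, ?_, ?_, ?_, ?_, ?_⟩
  · -- `C^∞` on the shell
    intro y hy
    by_cases hy0 : 0 < y 0
    · exact hθ_cone y hy hy0
    · refine (contDiffWithinAt_id.congr_of_eventuallyEq ?_ (by simp [transplant, hy0]))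
      filter_upwards [hθ_off y hy hy0] with y' hy'
      exact hy'.1
  · -- the inverse is `C^∞` on the shell
    intro y hy
    by_cases hy0 : 0 < y 0
    · have hw := fromBall_mem_slab hη hy
      by_cases hc : ‖tail k (fromBall y)‖ < R₂ + 1 / 2
      · -- the formula, a germ of a smooth map
        have hC : IsOpen {y' : 𝔼 (k + 1) | 0 < y' 0 ∧ ‖tail k (fromBall y')‖ < R₂ + 1 / 2} := by
          have : {y' : 𝔼 (k + 1) | 0 < y' 0 ∧ ‖tail k (fromBall y')‖ < R₂ + 1 / 2} =
              {y' | 0 < y' 0} ∩ (fun y' => ‖tail k (fromBall y')‖) ⁻¹' Iio (R₂ + 1 / 2) := rfl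
          rw [this]
          exact ((continuous_norm.comp (contDiff_tail k).continuous).comp_continuousOn
            contDiffOn_fromBall.continuousOn).isOpen_inter_preimage hcone isOpen_Iio
        have hgerm : ContDiffAt ℝ ∞ (fun y => toBall (M.symm (fromBall y))) y := by
          have htgt : fromBall y ∈ M.target := h.box_subset_target
            ⟨abs_fromBall_lt hη hy, by linarith⟩
          have h2 : ContDiffAt ℝ ∞ M.symm (fromBall y) :=
            h.contDiffOn_symm.contDiffAt (M.open_target.mem_nhds htgt)
          exact contDiff_toBall.contDiffAt.comp y (h2.comp y (contDiffAt_fromBall hy0))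
        refine (hgerm.contDiffWithinAt.congr_of_eventuallyEq ?_
          (by rw [transplantInv, if_pos ⟨hy0, hc⟩]))
        filter_upwards [mem_nhdsWithin_of_mem_nhds (hC.mem_nhds ⟨hy0, hc⟩)] with y' hy'
        rw [transplantInv, if_pos hy']
      · -- large tail: the inverse is the identity nearby
        have hO : IsOpen {y' : 𝔼 (k + 1) | 0 < y' 0 ∧ R₁ < ‖tail k (fromBall y')‖} := by
          have : {y' : 𝔼 (k + 1) | 0 < y' 0 ∧ R₁ < ‖tail k (fromBall y')‖} =
              {y' | 0 < y' 0} ∩ (fun y' => ‖tail k (fromBall y')‖) ⁻¹' Ioi R₁ := rfl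
          rw [this]
          exact ((continuous_norm.comp (contDiff_tail k).continuous).comp_continuousOn
            contDiffOn_fromBall.continuousOn).isOpen_inter_preimage hcone isOpen_Ioi
        have hyO : 0 < y 0 ∧ R₁ < ‖tail k (fromBall y)‖ :=
          ⟨hy0, by linarith [h.R₁_le, le_of_not_gt hc]⟩
        refine contDiffWithinAt_id.congr_of_eventuallyEq ?_
          (by rw [transplantInv, if_neg (fun h' => hc h'.2), _root_.id])
        filter_upwards [mem_nhdsWithin_of_mem_nhds (hO.mem_nhds hyO), self_mem_nhdsWithin]
          with y' hy'O hy's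
        rw [transplantInv]
        split_ifs with hc'
        · rw [h.symm_eq_self (abs_fromBall_lt hη hy's) (by linarith [hc'.2]) hy'O.2.le,
            toBall_fromBall hy'O.1, _root_.id]
        · rfl
    · refine (contDiffWithinAt_id.congr_of_eventuallyEq ?_ ?_)
      · filter_upwards [hθ_off y hy hy0] with y' hy'
        exact hy'.2
      · rw [transplantInv, if_neg (fun hc => hy0 hc.1), _root_.id]
  · -- the sphere is fixed
    intro y hy1
    by_cases hy0 : 0 < y 0
    · have hw0 : fromBall y 0 = 0 := by rw [fromBall_apply_zero, hy1, Real.log_one, neg_zero]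
      rw [transplant, if_pos hy0, h.eq_self_of_eq_zero _ hw0, toBall_fromBall hy0]
    · rw [transplant, if_neg hy0]
  · -- into the closed ball
    intro y hy
    by_cases hy0 : 0 < y 0
    · have hw := fromBall_mem_slab hη hy
      rw [transplant, if_pos hy0, norm_toBall_le_one_iff]
      exact h.apply_zero_nonneg hw.1 hw.2
    · rw [transplant, if_neg hy0]; exact (mem_closedShell_iff.1 hy).2
  · -- the open shell into the open ball
    intro y hy hy1
    by_cases hy0 : 0 < y 0
    · have hw := fromBall_mem_slab hη hy
      have hn := norm_pos_of_mem_closedShell hη hy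
      have hw0 : 0 < fromBall y 0 := by
        rw [fromBall_apply_zero, neg_pos]; exact Real.log_neg hn hy1
      rw [transplant, if_pos hy0, norm_toBall_lt_one_iff]
      exact h.apply_zero_pos _ hw0 hw.2
    · rw [transplant, if_neg hy0]; exact hy1
  · -- left inverse
    intro y hy _
    by_cases hy0 : 0 < y 0
    · have hw := fromBall_mem_slab hη hy
      rw [transplant, if_pos hy0]
      set w := fromBall y with hw_def
      by_cases hsmall : ‖tail k w‖ < R₂ + 1 / 2
      · have htail : ‖tail k (μ w)‖ < R₂ + 1 / 2 :=
          h.norm_tail_apply_lt hw.1 hw.2 (by linarith) hsmall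
        rw [transplantInv, if_pos ⟨toBall_apply_zero_pos _, by rwa [fromBall_toBall]⟩,
          fromBall_toBall, h.symm_apply hw.1 hw.2 (by linarith), hw_def, toBall_fromBall hy0]
      · have hbig : R₁ ≤ ‖tail k w‖ := by linarith [h.R₁_le, le_of_not_gt hsmall]
        have hμ : μ w = w := h.eq_self_of_le_norm w hw.1 hw.2 hbig
        rw [hμ, transplantInv, fromBall_toBall, if_neg (fun hc => hsmall hc.2), hw_def,
          toBall_fromBall hy0]
    · rw [transplant, if_neg hy0, transplantInv, if_neg (fun hc => hy0 hc.1)]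

/-! #### The splice of the transplant on the closed ball -/

section Splice

variable {ε₃ c C₁ L : ℝ}

open IsInnerCollar in
/-- The splice keeps the cone `{0 < y 0}`: it is a convex combination of `y` and `θ y`, both in
the cone. [folklore] -/
theorem splice_apply_zero_pos (μ : 𝔼 (k + 1) → 𝔼 (k + 1)) (L : ℝ) {y : 𝔼 (k + 1)} (hy : 0 < y 0) :
    0 < splice (transplant μ) L y 0 := by
  have hρ := logCutoff_mem_Icc L (1 - ‖y‖)
  have hθ : 0 < transplant μ y 0 := by rw [transplant, if_pos hy]; exact toBall_apply_zero_pos _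
  have : splice (transplant μ) L y 0 =
      (1 - logCutoff L (1 - ‖y‖)) * y 0 + logCutoff L (1 - ‖y‖) * transplant μ y 0 := by
    simp only [splice_apply, PiLp.add_apply, PiLp.smul_apply, PiLp.sub_apply, smul_eq_mul]; ring
  rw [this]
  rcases hρ.2.lt_or_eq with h1 | h1
  · exact add_pos_of_pos_of_nonneg (mul_pos (by linarith) hy) (mul_nonneg hρ.1 hθ.le)
  · rw [h1]; simpa using hθ

open IsInnerCollar in
/-- Conversely, off the cone the splice is the identity, so a point whose splice lies in the cone
lies in the cone. [folklore] -/
theorem apply_zero_pos_of_splice (μ : 𝔼 (k + 1) → 𝔼 (k + 1)) (L : ℝ) {y : 𝔼 (k + 1)}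
    (hy : 0 < splice (transplant μ) L y 0) : 0 < y 0 := by
  by_contra h0
  have : transplant μ y = y := by rw [transplant, if_neg h0]
  rw [splice_apply, this, sub_self, smul_zero, add_zero] at hy
  exact h0 hy



open IsInnerCollar

variable (h : IsSupportedFlatCollar η R₁ R₂ μ M)
  (hs : SpliceHyp (shellWidth η) (transplant μ) ε₃ c C₁ L)
include h hs

/-- Near the sphere, within the closed ball, the splice is the transplanted collar. [folklore] -/
theorem splice_eventuallyEq {x : 𝔼 (k + 1)} (hx : ‖x‖ = 1) :
    splice (transplant μ) L =ᶠ[𝓝[closedBall (0 : 𝔼 (k + 1)) 1] x] transplant μ := by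
  have ho : IsOpen {y : 𝔼 (k + 1) | 1 - exp (-2 * L) < ‖y‖} := isOpen_lt continuous_const continuous_norm
  have hx' : 1 - exp (-2 * L) < ‖x‖ := by rw [hx]; linarith [exp_pos (-2 * L)]
  filter_upwards [mem_nhdsWithin_of_mem_nhds (ho.mem_nhds hx'), self_mem_nhdsWithin] with y hy hyb
  rw [mem_closedBall_zero_iff] at hyb
  rcases hyb.lt_or_eq with hlt | heq
  · exact splice_eq hs.L_pos (le_of_lt hy) hlt
  · rw [h.isInnerCollar_transplant.splice_eq_self_of_norm_eq_one L heq,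
      h.isInnerCollar_transplant.eq_self y heq]

/-- **The splice is `C^∞` on the closed unit ball** (within; at the sphere it is the collar).
[folklore] -/
theorem contDiffOn_splice_closedBall :
    ContDiffOn ℝ ∞ (splice (transplant μ) L) (closedBall (0 : 𝔼 (k + 1)) 1) := by
  intro x hx
  rw [mem_closedBall_zero_iff] at hx
  rcases hx.lt_or_eq with hlt | heq
  · exact (h.isInnerCollar_transplant.contDiffAt_splice hs.L_pos hs.exp_lt_ε hlt).contDiffWithinAt
  · have hxs : x ∈ (closedShell (shellWidth η) : Set (𝔼 (k + 1))) :=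
      mem_closedShell_of_norm_eq_one (shellWidth_pos h.η_pos) heq
    have hθ : ContDiffWithinAt ℝ ∞ (transplant μ) (closedBall 0 1) x :=
      (h.isInnerCollar_transplant.contDiffOn x hxs).mono_of_mem_nhdsWithin
        (closedShell_mem_nhdsWithin hxs)
    exact hθ.congr_of_eventuallyEq (h.splice_eventuallyEq hs heq)
      (by rw [h.isInnerCollar_transplant.splice_eq_self_of_norm_eq_one L heq,
        h.isInnerCollar_transplant.eq_self x heq])

/-- The splice is continuous on the closed unit ball. [folklore] -/
theorem continuousOn_splice_closedBall :
    ContinuousOn (splice (transplant μ) L) (closedBall (0 : 𝔼 (k + 1)) 1) :=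
  (h.contDiffOn_splice_closedBall hs).continuousOn

/-- The splice is a bijection of the closed unit ball (a bijection of the open ball fixing the
sphere). [folklore] -/
theorem bijOn_splice_closedBall :
    BijOn (splice (transplant μ) L) (closedBall (0 : 𝔼 (k + 1)) 1) (closedBall 0 1) := by
  have hic := h.isInnerCollar_transplant
  have hb := hs.bijOn_splice hic
  refine ⟨fun x hx => ?_, fun x hx y hy hxy => ?_, fun y hy => ?_⟩
  · rw [mem_closedBall_zero_iff] at hx ⊢
    rcases hx.lt_or_eq with hlt | heq
    · exact (mem_ball_zero_iff.1 (hb.mapsTo (mem_ball_zero_iff.2 hlt))).le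
    · rw [hic.splice_eq_self_of_norm_eq_one L heq, heq]
  · rw [mem_closedBall_zero_iff] at hx hy
    rcases hx.lt_or_eq with hx1 | hx1 <;> rcases hy.lt_or_eq with hy1 | hy1
    · exact hb.injOn (mem_ball_zero_iff.2 hx1) (mem_ball_zero_iff.2 hy1) hxy
    · exfalso
      have h1 := mem_ball_zero_iff.1 (hb.mapsTo (mem_ball_zero_iff.2 hx1))
      rw [hxy, hic.splice_eq_self_of_norm_eq_one L hy1, hy1] at h1
      exact lt_irrefl _ h1
    · exfalso
      have h1 := mem_ball_zero_iff.1 (hb.mapsTo (mem_ball_zero_iff.2 hy1))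
      rw [← hxy, hic.splice_eq_self_of_norm_eq_one L hx1, hx1] at h1
      exact lt_irrefl _ h1
    · rw [hic.splice_eq_self_of_norm_eq_one L hx1, hic.splice_eq_self_of_norm_eq_one L hy1] at hxy
      exact hxy
  · rw [mem_closedBall_zero_iff] at hy
    rcases hy.lt_or_eq with hlt | heq
    · obtain ⟨x, hx, rfl⟩ := hb.surjOn (mem_ball_zero_iff.2 hlt)
      exact ⟨x, ball_subset_closedBall hx, rfl⟩
    · exact ⟨y, mem_closedBall_zero_iff.2 hy, hic.splice_eq_self_of_norm_eq_one L heq⟩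

/-- **The inverse of the splice on the closed ball**: the inverse of the splice homeomorphism of
the open ball, extended by the identity. [folklore] -/
def spliceInv (y : 𝔼 (k + 1)) : 𝔼 (k + 1) :=
  if ‖y‖ < 1 then (hs.spliceHomeomorph h.isInnerCollar_transplant).symm y else y

/-- The inverse of the splice maps the closed ball into itself, the open ball into itself.
[folklore] -/
theorem norm_spliceInv_le {y : 𝔼 (k + 1)} (hy : ‖y‖ ≤ 1) : ‖h.spliceInv hs y‖ ≤ 1 := by
  rw [spliceInv]
  split_ifs with h1
  · have := (hs.spliceHomeomorph h.isInnerCollar_transplant).map_target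
      (by rw [SpliceHyp.spliceHomeomorph_target]; exact mem_ball_zero_iff.2 h1)
    rw [SpliceHyp.spliceHomeomorph_source] at this
    exact (mem_ball_zero_iff.1 this).le
  · exact hy

/-- `splice ∘ spliceInv = id` on the closed ball. [folklore] -/
theorem splice_spliceInv {y : 𝔼 (k + 1)} (hy : ‖y‖ ≤ 1) :
    splice (transplant μ) L (h.spliceInv hs y) = y := by
  rw [spliceInv]
  split_ifs with h1
  · have := (hs.spliceHomeomorph h.isInnerCollar_transplant).right_inv
      (by rw [SpliceHyp.spliceHomeomorph_target]; exact mem_ball_zero_iff.2 h1)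
    rwa [SpliceHyp.spliceHomeomorph_coe] at this
  · exact h.isInnerCollar_transplant.splice_eq_self_of_norm_eq_one L (le_antisymm hy (not_lt.1 h1))

/-- `spliceInv ∘ splice = id` on the closed ball. [folklore] -/
theorem spliceInv_splice {x : 𝔼 (k + 1)} (hx : ‖x‖ ≤ 1) :
    h.spliceInv hs (splice (transplant μ) L x) = x :=
  (h.bijOn_splice_closedBall hs).injOn
    (mem_closedBall_zero_iff.2 (h.norm_spliceInv_le hs
      (mem_closedBall_zero_iff.1 ((h.bijOn_splice_closedBall hs).mapsTo (mem_closedBall_zero_iff.2 hx)))))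
    (mem_closedBall_zero_iff.2 hx)
    (h.splice_spliceInv hs
      (mem_closedBall_zero_iff.1 ((h.bijOn_splice_closedBall hs).mapsTo (mem_closedBall_zero_iff.2 hx))))

/-- **The inverse of the splice is continuous on the closed ball** (the splice is a continuous
bijection of the compact Hausdorff closed ball). [folklore] -/
theorem continuousOn_spliceInv : ContinuousOn (h.spliceInv hs) (closedBall (0 : 𝔼 (k + 1)) 1) := by
  haveI : CompactSpace (closedBall (0 : 𝔼 (k + 1)) 1) :=
    isCompact_iff_compactSpace.1 (isCompact_closedBall _ _)
  have hb := h.bijOn_splice_closedBall hs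
  set e : closedBall (0 : 𝔼 (k + 1)) 1 ≃ closedBall (0 : 𝔼 (k + 1)) 1 := hb.equiv _ with he
  have hec : Continuous e := (h.continuousOn_splice_closedBall hs).mapsToRestrict hb.mapsTo
  set H := Continuous.homeoOfEquivCompactToT2 hec with hH
  have hHe : ∀ x, (H x).val = splice (transplant μ) L x.val := fun x => rfl
  -- `spliceInv` is `H.symm` on the closed ball
  have hval : ∀ y : closedBall (0 : 𝔼 (k + 1)) 1, h.spliceInv hs y.val = (H.symm y).val := by
    intro y
    have h1 : splice (transplant μ) L (H.symm y).val = y.val := by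
      rw [← hHe, H.apply_symm_apply]
    have h2 : splice (transplant μ) L (h.spliceInv hs y.val) = y.val :=
      h.splice_spliceInv hs (mem_closedBall_zero_iff.1 y.2)
    exact hb.injOn
      (mem_closedBall_zero_iff.2 (h.norm_spliceInv_le hs (mem_closedBall_zero_iff.1 y.2)))
      (H.symm y).2 (h2.trans h1.symm)
  rw [continuousOn_iff_continuous_restrict]
  have : (closedBall (0 : 𝔼 (k + 1)) 1).restrict (h.spliceInv hs) = Subtype.val ∘ H.symm := by
    ext1 y; exact hval y
  rw [this]
  exact continuous_subtype_val.comp H.symm.continuous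

/-- The inverse of the splice is `C^∞` on the open ball. [folklore] -/
theorem contDiffAt_spliceInv {y : 𝔼 (k + 1)} (hy : ‖y‖ < 1) : ContDiffAt ℝ ∞ (h.spliceInv hs) y := by
  have hev : h.spliceInv hs =ᶠ[𝓝 y] (hs.spliceHomeomorph h.isInnerCollar_transplant).symm := by
    filter_upwards [(isOpen_lt continuous_norm continuous_const).mem_nhds hy] with y' hy'
    rw [spliceInv, if_pos hy']
  refine ContDiffAt.congr_of_eventuallyEq ?_ hev
  exact (hs.contDiffOn_spliceHomeomorph_symm h.isInnerCollar_transplant).contDiffAt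
    (isOpen_ball.mem_nhds (mem_ball_zero_iff.2 hy))

/-- A point whose splice-inverse is computed in the cone lies in the cone. [folklore] -/
theorem spliceInv_apply_zero_pos {y : 𝔼 (k + 1)} (hy : ‖y‖ ≤ 1) (hy0 : 0 < y 0) :
    0 < h.spliceInv hs y 0 := by
  apply apply_zero_pos_of_splice μ L
  rw [h.splice_spliceInv hs hy]; exact hy0



/-! #### `C^∞` regularity of the inverse splice up to the sphere -/

/-- Near the sphere, within the closed ball, the inverse of the splice is the inverse
transplanted collar. [folklore] -/
theorem spliceInv_eventuallyEq {x : 𝔼 (k + 1)} (hx : ‖x‖ = 1) :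
    h.spliceInv hs =ᶠ[𝓝[closedBall (0 : 𝔼 (k + 1)) 1] x] transplantInv R₂ M := by
  have hic := h.isInnerCollar_transplant
  have hcont : ContinuousWithinAt (h.spliceInv hs) (closedBall 0 1) x :=
    h.continuousOn_spliceInv hs x (mem_closedBall_zero_iff.2 hx.le)
  have hx' : h.spliceInv hs x = x := by
    rw [spliceInv, if_neg (by rw [hx]; exact lt_irrefl 1)]
  have hO : IsOpen {z : 𝔼 (k + 1) | 1 - exp (-2 * L) < ‖z‖} :=
    isOpen_lt continuous_const continuous_norm
  have hxO : 1 - exp (-2 * L) < ‖x‖ := by rw [hx]; linarith [exp_pos (-2 * L)]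
  have h1 : ∀ᶠ y in 𝓝[closedBall (0 : 𝔼 (k + 1)) 1] x, 1 - exp (-2 * L) < ‖h.spliceInv hs y‖ :=
    hcont (hO.mem_nhds (by rw [Set.mem_setOf_eq, hx']; exact hxO))
  have hO2 : IsOpen {y : 𝔼 (k + 1) | 1 - shellWidth η < ‖y‖} := isOpen_lt continuous_const continuous_norm
  have hxO2 : 1 - shellWidth η < ‖x‖ := by rw [hx]; linarith [shellWidth_pos h.η_pos]
  have h2L : exp (-2 * L) < shellWidth η :=
    (exp_lt_exp.2 (by linarith [hs.L_pos])).trans hs.exp_lt_ε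
  filter_upwards [h1, mem_nhdsWithin_of_mem_nhds (hO2.mem_nhds hxO2), self_mem_nhdsWithin]
    with y hy1 hy2 hyb
  rw [mem_closedBall_zero_iff] at hyb
  set z := h.spliceInv hs y with hz
  have hz1 : ‖z‖ ≤ 1 := h.norm_spliceInv_le hs hyb
  have hyz : splice (transplant μ) L z = y := h.splice_spliceInv hs hyb
  have hθz : transplant μ z = y := by
    rcases hz1.lt_or_eq with hlt | heq
    · rw [← hyz, splice_eq hs.L_pos hy1.le hlt]
    · rw [hic.eq_self z heq, ← hyz, hic.splice_eq_self_of_norm_eq_one L heq]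
  have hzs : z ∈ (closedShell (shellWidth η) : Set (𝔼 (k + 1))) :=
    mem_closedShell_iff.2 ⟨by linarith, hz1⟩
  have hys : transplant μ z ∈ (closedShell (shellWidth η) : Set (𝔼 (k + 1))) := by
    rw [hθz]; exact mem_closedShell_iff.2 ⟨hy2, hyb⟩
  rw [← hθz, hic.left_inv z hzs hys]

/-- **The inverse of the splice is `C^∞` on the closed unit ball** (within; at the sphere it is
the inverse collar). [folklore] -/
theorem contDiffOn_spliceInv_closedBall :
    ContDiffOn ℝ ∞ (h.spliceInv hs) (closedBall (0 : 𝔼 (k + 1)) 1) := by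
  intro x hx
  rcases (mem_closedBall_zero_iff.1 hx).lt_or_eq with hlt | heq
  · exact (h.contDiffAt_spliceInv hs hlt).contDiffWithinAt
  · have hxs : x ∈ (closedShell (shellWidth η) : Set (𝔼 (k + 1))) :=
      mem_closedShell_of_norm_eq_one (shellWidth_pos h.η_pos) heq
    have hθ : ContDiffWithinAt ℝ ∞ (transplantInv R₂ M) (closedBall 0 1) x :=
      (h.isInnerCollar_transplant.contDiffOn_symm x hxs).mono_of_mem_nhdsWithin
        (closedShell_mem_nhdsWithin hxs)
    have hev := h.spliceInv_eventuallyEq hs heq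
    exact hθ.congr_of_eventuallyEq hev (hev.eq_of_nhdsWithin hx)

/-! ### §4 Back to the half space

Conjugating the splice by the transplant gives a bijection `Θ = fromBall ∘ splice ∘ toBall` of the
closed half space `{0 ≤ w 0}`, `C^∞` in the within sense together with its inverse, which is `μ`
on a slab `{0 ≤ w 0 ≤ η₁}`, the identity on `{η₂ ≤ w 0}` and wherever `‖tail w‖ ≥ R₁`, and fixes
the hyperplane `{w 0 = 0}` pointwise. -/

omit h hs in
/-- **The half-space splice** `fromBall ∘ splice ∘ toBall`. [folklore] -/
def halfSplice (μ : 𝔼 (k + 1) → 𝔼 (k + 1)) (L : ℝ) (w : 𝔼 (k + 1)) : 𝔼 (k + 1) :=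
  fromBall (splice (transplant μ) L (toBall w))

/-- **Its inverse** `fromBall ∘ splice⁻¹ ∘ toBall`. [folklore] -/
def halfSpliceInv (w : 𝔼 (k + 1)) : 𝔼 (k + 1) := fromBall (h.spliceInv hs (toBall w))

omit h hs in
/-- The half space goes to the closed ball under the transplant. [folklore] -/
theorem norm_toBall_le_one {w : 𝔼 (k + 1)} (hw : 0 ≤ w 0) : ‖toBall w‖ ≤ 1 :=
  (norm_toBall_le_one_iff w).2 hw

/-- The splice of a transplanted half-space point lies in the closed ball. [folklore] -/
theorem norm_splice_toBall_le_one {w : 𝔼 (k + 1)} (hw : 0 ≤ w 0) :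
    ‖splice (transplant μ) L (toBall w)‖ ≤ 1 :=
  mem_closedBall_zero_iff.1 ((h.bijOn_splice_closedBall hs).mapsTo
    (mem_closedBall_zero_iff.2 (norm_toBall_le_one hw)))

/-- **The half-space splice preserves the closed half space.** [folklore] -/
theorem halfSplice_apply_zero_nonneg {w : 𝔼 (k + 1)} (hw : 0 ≤ w 0) :
    0 ≤ halfSplice μ L w 0 := by
  have hy0 := splice_apply_zero_pos μ L (toBall_apply_zero_pos w)
  have hn : 0 < ‖splice (transplant μ) L (toBall w)‖ :=
    norm_pos_iff.2 fun h0 => by rw [h0] at hy0; exact lt_irrefl _ hy0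
  rw [halfSplice, fromBall_apply_zero]
  exact neg_log_norm_nonneg hn (h.norm_splice_toBall_le_one hs hw)

/-- The inverse half-space splice preserves the closed half space. [folklore] -/
theorem halfSpliceInv_apply_zero_nonneg {w : 𝔼 (k + 1)} (hw : 0 ≤ w 0) :
    0 ≤ h.halfSpliceInv hs w 0 := by
  have h1 := norm_toBall_le_one hw
  have hy0 := h.spliceInv_apply_zero_pos hs h1 (toBall_apply_zero_pos w)
  have hn : 0 < ‖h.spliceInv hs (toBall w)‖ :=
    norm_pos_iff.2 fun h0 => by rw [h0] at hy0; exact lt_irrefl _ hy0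
  rw [halfSpliceInv, fromBall_apply_zero]
  exact neg_log_norm_nonneg hn (h.norm_spliceInv_le hs h1)

/-- **The half-space splice is `C^∞` on the closed half space** (within). [folklore] -/
theorem contDiffOn_halfSplice : ContDiffOn ℝ ∞ (halfSplice μ L) {w | 0 ≤ w 0} := by
  have h1 : ContDiffOn ℝ ∞ (fun w => splice (transplant μ) L (toBall w)) {w : 𝔼 (k + 1) | 0 ≤ w 0} :=
    (h.contDiffOn_splice_closedBall hs).comp contDiff_toBall.contDiffOn
      fun w hw => mem_closedBall_zero_iff.2 (norm_toBall_le_one hw)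
  exact contDiffOn_fromBall.comp h1 fun w _ => splice_apply_zero_pos μ L (toBall_apply_zero_pos w)

/-- **The inverse half-space splice is `C^∞` on the closed half space** (within). [folklore] -/
theorem contDiffOn_halfSpliceInv : ContDiffOn ℝ ∞ (h.halfSpliceInv hs) {w | 0 ≤ w 0} := by
  have h1 : ContDiffOn ℝ ∞ (fun w => h.spliceInv hs (toBall w)) {w : 𝔼 (k + 1) | 0 ≤ w 0} :=
    (h.contDiffOn_spliceInv_closedBall hs).comp contDiff_toBall.contDiffOn
      fun w hw => mem_closedBall_zero_iff.2 (norm_toBall_le_one hw)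
  exact contDiffOn_fromBall.comp h1 fun w hw =>
    h.spliceInv_apply_zero_pos hs (norm_toBall_le_one hw) (toBall_apply_zero_pos w)

/-- `Θ⁻¹ ∘ Θ = id` on the closed half space. [folklore] -/
theorem halfSpliceInv_halfSplice {w : 𝔼 (k + 1)} (hw : 0 ≤ w 0) :
    h.halfSpliceInv hs (halfSplice μ L w) = w := by
  rw [halfSpliceInv, halfSplice,
    toBall_fromBall (splice_apply_zero_pos μ L (toBall_apply_zero_pos w)),
    h.spliceInv_splice hs (norm_toBall_le_one hw), fromBall_toBall]

/-- `Θ ∘ Θ⁻¹ = id` on the closed half space. [folklore] -/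
theorem halfSplice_halfSpliceInv {w : 𝔼 (k + 1)} (hw : 0 ≤ w 0) :
    halfSplice μ L (h.halfSpliceInv hs w) = w := by
  have h1 := norm_toBall_le_one hw
  rw [halfSplice, halfSpliceInv,
    toBall_fromBall (h.spliceInv_apply_zero_pos hs h1 (toBall_apply_zero_pos w)),
    h.splice_spliceInv hs h1, fromBall_toBall]

/-- The depth `-log (1 - δ)` at which a point of the half space is transplanted to norm `1 - δ`.
[folklore] -/
def depth (δ : ℝ) : ℝ := -Real.log (1 - δ)

omit h hs in
/-- For `0 < δ < 1` the depth is positive. [folklore] -/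
theorem depth_pos {δ : ℝ} (h0 : 0 < δ) (h1 : δ < 1) : 0 < depth δ := by
  rw [depth, neg_pos]; exact Real.log_neg (by linarith) (by linarith)

omit h hs in
/-- The depth is monotone. [folklore] -/
theorem depth_le_depth {δ δ' : ℝ} (hδ : δ ≤ δ') (h1 : δ' < 1) : depth δ ≤ depth δ' := by
  rw [depth, depth, neg_le_neg_iff]
  exact Real.log_le_log (by linarith) (by linarith)

omit h hs in
/-- Points of depth at most `depth δ` are transplanted to norm at least `1 - δ`. [folklore] -/
theorem le_norm_toBall_of_le_depth {δ : ℝ} (h1 : δ < 1) {w : 𝔼 (k + 1)} (hw : w 0 ≤ depth δ) :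
    1 - δ ≤ ‖toBall w‖ := by
  rw [norm_toBall]
  have : Real.exp (-depth δ) = 1 - δ := by
    rw [depth, neg_neg, Real.exp_log (by linarith)]
  rw [← this]
  exact Real.exp_le_exp.2 (by linarith)

omit h hs in
/-- Points of depth at least `depth δ` are transplanted to norm at most `1 - δ`. [folklore] -/
theorem norm_toBall_le_of_depth_le {δ : ℝ} (h1 : δ < 1) {w : 𝔼 (k + 1)} (hw : depth δ ≤ w 0) :
    ‖toBall w‖ ≤ 1 - δ := by
  rw [norm_toBall]
  have : Real.exp (-depth δ) = 1 - δ := by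
    rw [depth, neg_neg, Real.exp_log (by linarith)]
  rw [← this]
  exact Real.exp_le_exp.2 (by linarith)

/-- **Near the hyperplane the half-space splice is `μ`**: on the slab
`{0 ≤ w 0 ≤ depth (e^{-2L})}`. [folklore] -/
theorem halfSplice_eq_of_le {w : 𝔼 (k + 1)} (hw : 0 ≤ w 0) (hw' : w 0 ≤ depth (exp (-2 * L))) :
    halfSplice μ L w = μ w := by
  have hic := h.isInnerCollar_transplant
  have hlt1 : exp (-2 * L) < 1 := (exp_lt_exp.2 (by linarith [hs.L_pos])).trans hs.exp_lt_one
  have hn := le_norm_toBall_of_le_depth hlt1 hw'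
  rw [halfSplice]
  rcases hw.lt_or_eq with hpos | h0
  · have hlt : ‖toBall w‖ < 1 := (norm_toBall_lt_one_iff w).2 hpos
    rw [splice_eq hs.L_pos hn hlt, transplant, if_pos (toBall_apply_zero_pos w), fromBall_toBall,
      fromBall_toBall]
  · have heq : ‖toBall w‖ = 1 := (norm_toBall_eq_one_iff w).2 h0.symm
    rw [hic.splice_eq_self_of_norm_eq_one L heq, fromBall_toBall, h.eq_self_of_eq_zero w h0.symm]

omit h in
/-- **Deep inside the half-space splice is the identity**: on `{depth (e^{-L}) ≤ w 0}`.
[folklore] -/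
theorem halfSplice_eq_self_of_le {w : 𝔼 (k + 1)} (hw : depth (exp (-L)) ≤ w 0) :
    halfSplice μ L w = w := by
  rw [halfSplice, splice_eq_self hs.L_pos (norm_toBall_le_of_depth_le hs.exp_lt_one hw),
    fromBall_toBall]

/-- **Far from the axis the half-space splice is the identity**: where `‖tail w‖ ≥ R₁`.
[folklore] -/
theorem halfSplice_eq_self_of_le_norm {w : 𝔼 (k + 1)} (hw : 0 ≤ w 0) (hR : R₁ ≤ ‖tail k w‖) :
    halfSplice μ L w = w := by
  have hic := h.isInnerCollar_transplant
  by_cases hdeep : depth (exp (-L)) ≤ w 0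
  · exact halfSplice_eq_self_of_le hs hdeep
  · -- in the shell: `μ w = w`, so the collar and hence the splice fix `toBall w`
    have hlt : ‖toBall w‖ ≤ 1 := norm_toBall_le_one hw
    have hgt : 1 - exp (-L) < ‖toBall w‖ := by
      rw [norm_toBall]
      have h1 : Real.exp (-depth (exp (-L))) = 1 - exp (-L) := by
        rw [depth, neg_neg, Real.exp_log (by linarith [hs.exp_lt_one])]
      rw [← h1]
      exact Real.exp_lt_exp.2 (by linarith [lt_of_not_ge hdeep])
    have hshell : toBall w ∈ (closedShell (shellWidth η) : Set (𝔼 (k + 1))) :=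
      mem_closedShell_iff.2 ⟨by linarith [hs.exp_lt_ε], hlt⟩
    have hslab := fromBall_mem_slab h.η_pos hshell
    rw [fromBall_toBall] at hslab
    have hμ : μ w = w := h.eq_self_of_le_norm w hw hslab.2 hR
    have hθ : transplant μ (toBall w) = toBall w := by
      rw [transplant, if_pos (toBall_apply_zero_pos w), fromBall_toBall, hμ]
    rw [halfSplice, splice_apply, hθ, sub_self, smul_zero, add_zero, fromBall_toBall]

/-- **The half-space splice fixes the hyperplane pointwise.** [folklore] -/
theorem halfSplice_eq_self_of_eq_zero {w : 𝔼 (k + 1)} (hw : w 0 = 0) : halfSplice μ L w = w := by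
  have hlt1 : exp (-2 * L) < 1 := (exp_lt_exp.2 (by linarith [hs.L_pos])).trans hs.exp_lt_one
  rw [h.halfSplice_eq_of_le hs hw.ge (by rw [hw]; exact (depth_pos (exp_pos _) hlt1).le),
    h.eq_self_of_eq_zero w hw]

omit h in
/-- The two depths are ordered: `depth (e^{-2L}) ≤ depth (e^{-L})`. [folklore] -/
theorem depth_le : depth (exp (-2 * L)) ≤ depth (exp (-L)) :=
  depth_le_depth (exp_le_exp.2 (by linarith [hs.L_pos])) hs.exp_lt_one

omit h in
/-- The inner depth is positive. [folklore] -/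
theorem depth_pos' : 0 < depth (exp (-2 * L)) :=
  depth_pos (exp_pos _) ((exp_lt_exp.2 (by linarith [hs.L_pos])).trans hs.exp_lt_one)

end Splice

end IsSupportedFlatCollar

end Transplant

/-! ### §5 Diffeomorphisms of the model half space from coordinate maps -/

section HalfSpace

/-- Local notation: `ℍ n` is the closed half space. -/
local notation "ℍ " n:arg => EuclideanHalfSpace n

/-- The self-map of the closed half space induced by a coordinate map preserving `{0 ≤ w 0}`.
[folklore] -/
def halfSpaceMk (F : 𝔼 (k + 1) → 𝔼 (k + 1)) (hF0 : ∀ w : 𝔼 (k + 1), 0 ≤ w 0 → 0 ≤ F w 0) :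
    ℍ (k + 1) → ℍ (k + 1) := fun x => ⟨F x.val, hF0 x.val x.property⟩

/-- The induced map in coordinates. [folklore] -/
@[simp] theorem halfSpaceMk_val (F : 𝔼 (k + 1) → 𝔼 (k + 1))
    (hF0 : ∀ w : 𝔼 (k + 1), 0 ≤ w 0 → 0 ≤ F w 0) (x : ℍ (k + 1)) :
    (halfSpaceMk F hF0 x).val = F x.val := rfl

/-- **A within-`C^∞` self-map of the closed half space is `C^∞` for the model with boundary.**
If `F : ℝᵏ⁺¹ → ℝᵏ⁺¹` is `C^∞` on the closed half space `{0 ≤ w 0}` in the within sense and maps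
it into itself, the induced self-map of `EuclideanHalfSpace (k + 1)` is `C^∞` for `𝓡∂ (k + 1)`
(the charts of the half space are the inclusion into `ℝᵏ⁺¹`, read within the half space).
[folklore] -/
theorem contMDiff_halfSpaceMk {F : 𝔼 (k + 1) → 𝔼 (k + 1)} (hF : ContDiffOn ℝ ∞ F {w | 0 ≤ w 0})
    (hF0 : ∀ w : 𝔼 (k + 1), 0 ≤ w 0 → 0 ≤ F w 0) :
    ContMDiff (𝓡∂ (k + 1)) (𝓡∂ (k + 1)) ∞ (halfSpaceMk F hF0) := by
  have h3 : ContMDiff (𝓡∂ (k + 1)) 𝓘(ℝ, 𝔼 (k + 1)) ∞ (fun x : ℍ (k + 1) => F x.val) :=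
    hF.contMDiffOn.comp_contMDiff (𝓡∂ (k + 1)).contMDiff fun x => x.property
  have h4 : ContMDiff (𝓡∂ (k + 1)) (𝓡∂ (k + 1)) ∞
      (fun x : ℍ (k + 1) => (𝓡∂ (k + 1)).symm (F x.val)) :=
    (𝓡∂ (k + 1)).contMDiffOn_symm.comp_contMDiff h3 fun x => by
      rw [range_modelWithCornersEuclideanHalfSpace]; exact hF0 x.val x.property
  refine h4.congr fun x => Subtype.ext ?_
  rw [halfSpaceMk_val]
  exact ((𝓡∂ (k + 1)).right_inv (by
    rw [range_modelWithCornersEuclideanHalfSpace]; exact hF0 x.val x.property)).symm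

/-- **A diffeomorphism of the closed half space from a pair of mutually inverse coordinate maps**
`F`, `G`, each `C^∞` on `{0 ≤ w 0}` in the within sense and preserving it. [folklore] -/
def halfSpaceDiffeomorph (F G : 𝔼 (k + 1) → 𝔼 (k + 1)) (hF : ContDiffOn ℝ ∞ F {w | 0 ≤ w 0})
    (hG : ContDiffOn ℝ ∞ G {w | 0 ≤ w 0}) (hF0 : ∀ w : 𝔼 (k + 1), 0 ≤ w 0 → 0 ≤ F w 0)
    (hG0 : ∀ w : 𝔼 (k + 1), 0 ≤ w 0 → 0 ≤ G w 0) (hGF : ∀ w : 𝔼 (k + 1), 0 ≤ w 0 → G (F w) = w)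
    (hFG : ∀ w : 𝔼 (k + 1), 0 ≤ w 0 → F (G w) = w) :
    (ℍ (k + 1)) ≃ₘ⟮𝓡∂ (k + 1), 𝓡∂ (k + 1)⟯ (ℍ (k + 1)) where
  toFun := halfSpaceMk F hF0
  invFun := halfSpaceMk G hG0
  left_inv x := Subtype.ext (hGF x.val x.property)
  right_inv x := Subtype.ext (hFG x.val x.property)
  contMDiff_toFun := contMDiff_halfSpaceMk hF hF0
  contMDiff_invFun := contMDiff_halfSpaceMk hG hG0

/-- The action of `halfSpaceDiffeomorph` in coordinates. [folklore] -/
@[simp] theorem halfSpaceDiffeomorph_apply_val (F G : 𝔼 (k + 1) → 𝔼 (k + 1))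
    (hF : ContDiffOn ℝ ∞ F {w | 0 ≤ w 0}) (hG : ContDiffOn ℝ ∞ G {w | 0 ≤ w 0})
    (hF0 : ∀ w : 𝔼 (k + 1), 0 ≤ w 0 → 0 ≤ F w 0) (hG0 : ∀ w : 𝔼 (k + 1), 0 ≤ w 0 → 0 ≤ G w 0)
    (hGF : ∀ w : 𝔼 (k + 1), 0 ≤ w 0 → G (F w) = w) (hFG : ∀ w : 𝔼 (k + 1), 0 ≤ w 0 → F (G w) = w)
    (x : ℍ (k + 1)) :
    (halfSpaceDiffeomorph F G hF hG hF0 hG0 hGF hFG x).val = F x.val := rfl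

/-! ### §6 Main result: extension of a supported flat collar to a diffeomorphism of the half space -/

/-- **A compactly supported flat collar of the boundary of the half space extends to a
diffeomorphism** (uniqueness of collars, relative and compactly supported form). If `μ` is a
supported flat collar of the hyperplane `{w 0 = 0}` in the closed half space `ℝᵏ⁺¹₊`
(`Literature.Topology.FourManifolds.FlatCollar.IsSupportedFlatCollar`: `C^∞` on a slab, fixing the hyperplane pointwise, the
identity where `‖tail w‖ ≥ R₁`, with a two-sided local inverse), then there is a diffeomorphism
`Θ` of `ℝᵏ⁺¹₊` (for the model with boundary `𝓡∂ (k + 1)`) and depths `0 < η₁ ≤ η₂` such that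
`Θ = μ` on the slab `{w 0 ≤ η₁}`, `Θ = id` on `{η₂ ≤ w 0}` and wherever `‖tail w‖ ≥ R₁`, and `Θ`
fixes the hyperplane pointwise. (Transplant `μ` to an inner collar of the unit sphere in the
closed unit ball by `w ↦ e^{-w 0} (1, tail w)/√(1 + ‖tail w‖²)`, splice it with the identity
along a logarithmically slow radial cutoff — the tree's `Literature.Topology.FourManifolds.IsInnerCollar` splice,
`CollarUniquenessBall.lean` — and transplant back.) Hirsch, *Differential Topology* (1976),
Ch. 8, Thm. 1.8 and the remark following it on collars; Munkres, *Elementary Differential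
Topology* (1966), §6. [cite: HirschDT1976, Ch. 8 Thm. 1.8] -/
theorem IsSupportedFlatCollar.exists_diffeomorph {η R₁ R₂ : ℝ} {μ : 𝔼 (k + 1) → 𝔼 (k + 1)}
    {M : OpenPartialHomeomorph (𝔼 (k + 1)) (𝔼 (k + 1))} (h : IsSupportedFlatCollar η R₁ R₂ μ M) :
    ∃ (Θ : (ℍ (k + 1)) ≃ₘ⟮𝓡∂ (k + 1), 𝓡∂ (k + 1)⟯ (ℍ (k + 1))) (η₁ η₂ : ℝ), 0 < η₁ ∧ η₁ ≤ η₂ ∧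
      (∀ x : ℍ (k + 1), x.val 0 ≤ η₁ → (Θ x).val = μ x.val) ∧
      (∀ x : ℍ (k + 1), η₂ ≤ x.val 0 → Θ x = x) ∧
      (∀ x : ℍ (k + 1), R₁ ≤ ‖tail k x.val‖ → Θ x = x) ∧
      (∀ x : ℍ (k + 1), x.val 0 = 0 → Θ x = x) := by
  obtain ⟨ε₃, c, C₁, L, hs⟩ := h.isInnerCollar_transplant.exists_spliceHyp
  refine ⟨halfSpaceDiffeomorph (halfSplice μ L) (h.halfSpliceInv hs) (h.contDiffOn_halfSplice hs)
    (h.contDiffOn_halfSpliceInv hs) (fun w hw => h.halfSplice_apply_zero_nonneg hs hw)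
    (fun w hw => h.halfSpliceInv_apply_zero_nonneg hs hw)
    (fun w hw => h.halfSpliceInv_halfSplice hs hw) (fun w hw => h.halfSplice_halfSpliceInv hs hw),
    IsSupportedFlatCollar.depth (exp (-2 * L)), IsSupportedFlatCollar.depth (exp (-L)),
    IsSupportedFlatCollar.depth_pos' hs, IsSupportedFlatCollar.depth_le hs, fun x hx => ?_,
    fun x hx => ?_, fun x hx => ?_, fun x hx => ?_⟩
  · exact h.halfSplice_eq_of_le hs x.property hx
  · exact Subtype.ext (IsSupportedFlatCollar.halfSplice_eq_self_of_le hs hx)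
  · exact Subtype.ext (h.halfSplice_eq_self_of_le_norm hs x.property hx)
  · exact Subtype.ext (h.halfSplice_eq_self_of_eq_zero hs hx)

end HalfSpace

end FlatCollar

end Literature.Topology.FourManifolds
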